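import Summits.Parity.GeneralizedHardyLittlewood.Theorems.LeeYangFibresModelHyperbolicityDefs
import HarnessLib

/-!
# Stub `stub_windowChain` of line `window-chain-transport` for crux `LeeYangFibres.ModelHyperbolicity` (stmt-Parity-14110)

We prove `stub_windowChain : DensityCalculus → (∀ N, WindowChain N) ∧ NoNullWindow`: the
Hermite–Biehler positivity pair on every unit window of the model family `G_N(τ;z) = modelEval N τ z`
and backward uniqueness (no null window) for the delay equation, from the calculus bundle
`DensityCalculus` (only its clauses (C5) continuity, (C6) delay equation, (C7) Volterra identity are used).

* **Transport lemma** (`wc_transport`, abstract): if `w - c = z ∫_a^b G(u) du/u` (`0 < a ≤ b`, `G`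
  continuous, `Im z > 0`) and every `u ∈ [a,b]` satisfies `G u ≠ 0`, `c ≠ 0`, `Im(c/G u) ≥ 0`,
  `Im(z G u/c) > 0`, then `c ≠ 0`, `w ≠ 0`, `Im(w/c) ≥ 0`, `Im(z c/w) > 0`. Proof: with
  `K = ∫_a^b G(u)/(u c) du` one has `w = c (1 + z K)`, `Im K ≤ 0` and `Im(z K) ≥ 0` (imaginary part
  commutes with the interval integral, `intervalIntegral.integral_nonneg`), and `q = 1/z + K` has
  `Im q < 0`, whence `1 + zK = z q ≠ 0` and `Im(z c/w) = Im(q⁻¹) > 0`.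
* **Window chain** (`wc_chain`): induction on `k : ℕ` of the positivity pair for all
  `1 ≤ σ ≤ s ≤ σ + 1`, `s ≤ min(k, N)`. Both points `≤ 2`: `G ≡ 1` (`modelEval_of_le_two`). Step:
  pairs with `σ ≤ k < s` (first kind) are transported by (C7) from the pairs `(u, σ)`,
  `u ∈ [max(σ-1,1), s-1]`, covered by the induction hypothesis; pairs with `k < σ ≤ s ≤ k+1` (second
  kind) are transported from first-kind pairs `(u, σ)`.
* **No null window** (`wc_noNull`): if `G` vanished on `[a, a+1] ⊆ [1, N]` with `a > 2`, the delay
  equation (C6) and uniqueness of derivatives force `G = 0` on `(a-1, a)`, hence on `[a-1, a]` by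
  continuity; descending induction reaches a window with left end `≤ 2`, where `G = 1`.

References: line card `Cruxes/ModelHyperbolicity/Lines/window-chain-transport.md`; J. Borcea,
P. Brändén, Invent. Math. 177 (2009) (Hermite–Biehler / proper position); K. Alladi, Quart. J. Math.
Oxford (2) 33 (1982) 129–148 (the densities `I_j`).
-/

noncomputable section

namespace Summit.Parity.GeneralizedHardyLittlewood.Cruxes.ModelHyperbolicity.WindowChainTransport

open scoped BigOperators
open Polynomial Filter


/-! ## Helper lemmas -/

/-- **Transport of the positivity pair across one Volterra step** (abstract form). If
`w - c = z ∫_a^b G(u) du/u` with `0 < a ≤ b`, `G` continuous, `Im z > 0`, and every `u ∈ [a, b]`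
satisfies `G u ≠ 0`, `c ≠ 0`, `Im(c / G u) ≥ 0`, `Im(z G u / c) > 0`, then
`c ≠ 0`, `w ≠ 0`, `Im(w / c) ≥ 0` and `Im(z c / w) > 0`. -/
private theorem wc_transport {G : ℝ → ℂ} (hG : Continuous G) {z c w : ℂ} (hz : 0 < z.im)
    {a b : ℝ} (ha : 0 < a) (hab : a ≤ b)
    (hV : w - c = z * ∫ u in a..b, G u / (u : ℂ))
    (hgood : ∀ u ∈ Set.Icc a b, G u ≠ 0 ∧ c ≠ 0 ∧ 0 ≤ (c / G u).im ∧ 0 < (z * G u / c).im) :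
    c ≠ 0 ∧ w ≠ 0 ∧ 0 ≤ (w / c).im ∧ 0 < (z * c / w).im := by
  have hc : c ≠ 0 := (hgood a ⟨le_rfl, hab⟩).2.1
  have hzne : z ≠ 0 := by
    rintro rfl
    simp at hz
  -- the integrand after division by `c`, and its integral `K`
  have hFcont : ContinuousOn (fun u : ℝ => G u / (u : ℂ) / c) (Set.Icc a b) := by
    refine ContinuousOn.div_const
      (ContinuousOn.div hG.continuousOn Complex.continuous_ofReal.continuousOn fun u hu => ?_) c
    exact_mod_cast (ha.trans_le hu.1).ne'
  have hFint : IntervalIntegrable (fun u : ℝ => G u / (u : ℂ) / c) MeasureTheory.volume a b :=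
    hFcont.intervalIntegrable_of_Icc hab
  obtain ⟨K, hK⟩ : ∃ K : ℂ, K = ∫ u in a..b, G u / (u : ℂ) / c := ⟨_, rfl⟩
  have hI0 : (∫ u in a..b, G u / (u : ℂ)) = K * c := by
    rw [hK, intervalIntegral.integral_div, div_mul_cancel₀ _ hc]
  -- imaginary parts under the integral sign
  have hKim : K.im = ∫ u in a..b, (G u / (u : ℂ) / c).im := by
    have h := Complex.imCLM.intervalIntegral_comp_comm hFint
    simp only [Complex.imCLM_apply] at h
    rw [hK]
    exact h.symm
  have hzKim : (z * K).im = ∫ u in a..b, (z * (G u / (u : ℂ) / c)).im := by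
    have h := Complex.imCLM.intervalIntegral_comp_comm (hFint.const_mul z)
    simp only [Complex.imCLM_apply] at h
    rw [hK, ← intervalIntegral.integral_const_mul]
    exact h.symm
  -- pointwise signs of the two integrands
  have hpt : ∀ u ∈ Set.Icc a b,
      (G u / (u : ℂ) / c).im ≤ 0 ∧ 0 ≤ (z * (G u / (u : ℂ) / c)).im := by
    intro u hu
    obtain ⟨_, -, hPP, hSPP⟩ := hgood u hu
    have hu0 : 0 < u := ha.trans_le hu.1
    constructor
    · have h1 : G u / (u : ℂ) / c = (c / G u)⁻¹ / (u : ℂ) := by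
        rw [inv_div, div_right_comm]
      rw [h1, Complex.div_ofReal_im, Complex.inv_im]
      have h2 : -(c / G u).im / Complex.normSq (c / G u) ≤ 0 :=
        div_nonpos_of_nonpos_of_nonneg (neg_nonpos.2 hPP) (Complex.normSq_nonneg _)
      exact div_nonpos_of_nonpos_of_nonneg h2 hu0.le
    · have h1 : z * (G u / (u : ℂ) / c) = z * G u / c / (u : ℂ) := by ring
      rw [h1, Complex.div_ofReal_im]
      exact div_nonneg hSPP.le hu0.le
  have hK1 : K.im ≤ 0 := by
    have h : 0 ≤ ∫ u in a..b, -(G u / (u : ℂ) / c).im :=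
      intervalIntegral.integral_nonneg hab fun u hu => neg_nonneg.2 (hpt u hu).1
    rw [intervalIntegral.integral_neg, ← hKim] at h
    exact neg_nonneg.1 h
  have hK2 : 0 ≤ (z * K).im := by
    rw [hzKim]
    exact intervalIntegral.integral_nonneg hab fun u hu => (hpt u hu).2
  -- the algebra: `w = c (1 + z K) = c z q` with `q = z⁻¹ + K`, `Im q < 0`
  have hw : w = c * (1 + z * K) := by
    have h : w = c + z * (K * c) := by rw [← hI0, ← hV]; ring
    rw [h]; ring
  obtain ⟨q, hq⟩ : ∃ q : ℂ, q = z⁻¹ + K := ⟨_, rfl⟩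
  have hq_im : q.im < 0 := by
    have hnz : 0 < Complex.normSq z := Complex.normSq_pos.2 hzne
    have hinv : (z⁻¹).im < 0 := by
      rw [Complex.inv_im]
      exact div_neg_of_neg_of_pos (neg_neg_of_pos hz) hnz
    rw [hq, Complex.add_im]
    linarith
  have hq_ne : q ≠ 0 := by
    intro h
    rw [h, Complex.zero_im] at hq_im
    exact lt_irrefl _ hq_im
  have h1zK : 1 + z * K = z * q := by
    rw [hq, mul_add, mul_inv_cancel₀ hzne]
  refine ⟨hc, ?_, ?_, ?_⟩
  · rw [hw, h1zK]
    exact mul_ne_zero hc (mul_ne_zero hzne hq_ne)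
  · rw [hw, mul_div_cancel_left₀ _ hc, Complex.add_im, Complex.one_im, zero_add]
    exact hK2
  · have h : z * c / w = q⁻¹ := by
      rw [hw, h1zK]
      field_simp
    rw [h, Complex.inv_im]
    exact div_pos (neg_pos.2 hq_im) (Complex.normSq_pos.2 hq_ne)

/-- **The window chain** from continuity (C5) and the Volterra identity (C7): induction over the
integer ceiling of the right endpoint, each new window being transported from the previous one by
`wc_transport` (first kind: `σ ≤ k < s`; second kind: `k < σ ≤ s ≤ k + 1`, transported from
first-kind pairs). -/
private theorem wc_chain
    (hC5 : ∀ N : ℕ, ∀ z : ℂ, Continuous (fun τ : ℝ => modelEval N τ z))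
    (hC7 : ∀ N : ℕ, 2 ≤ N → ∀ z : ℂ, ∀ σ s : ℝ, 1 ≤ σ → σ ≤ s → s ≤ (N : ℝ) + 1 →
      modelEval N s z - modelEval N σ z =
        z * ∫ τ in max (σ - 1) 1..max (s - 1) 1, modelEval N τ z / (τ : ℂ))
    (N : ℕ) : WindowChain N := by
  intro σ₀ s₀ h1σ₀ hσs₀ hs1₀ hsN₀ z hz
  -- base: both points on the flat window `≤ 2`, where `G ≡ 1`
  have hbase : ∀ σ s : ℝ, 1 ≤ σ → σ ≤ (N : ℝ) → σ ≤ 2 → s ≤ 2 →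
      modelEval N σ z ≠ 0 ∧ modelEval N s z ≠ 0 ∧
        0 ≤ (modelEval N s z / modelEval N σ z).im ∧
          0 < (z * modelEval N σ z / modelEval N s z).im := by
    intro σ s h1 hσN hσ2 hs2
    have hN1 : 1 ≤ N := by exact_mod_cast h1.trans hσN
    rw [modelEval_of_le_two hN1 hσ2, modelEval_of_le_two hN1 hs2]
    exact ⟨one_ne_zero, one_ne_zero, by simp, by simpa using hz⟩
  -- transport across one Volterra step (C7), for a right endpoint `s > 2`
  have htrans : ∀ σ s : ℝ, 1 ≤ σ → σ ≤ s → 2 < s → s ≤ (N : ℝ) →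
      (∀ u ∈ Set.Icc (max (σ - 1) 1) (s - 1),
        modelEval N u z ≠ 0 ∧ modelEval N σ z ≠ 0 ∧
          0 ≤ (modelEval N σ z / modelEval N u z).im ∧
            0 < (z * modelEval N u z / modelEval N σ z).im) →
      modelEval N σ z ≠ 0 ∧ modelEval N s z ≠ 0 ∧
        0 ≤ (modelEval N s z / modelEval N σ z).im ∧
          0 < (z * modelEval N σ z / modelEval N s z).im := by
    intro σ s h1σ hσs h2s hsN hgood
    have hN2 : 2 ≤ N := by exact_mod_cast (h2s.le.trans hsN : (2 : ℝ) ≤ N)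
    have hV := hC7 N hN2 z σ s h1σ hσs (by linarith)
    rw [show max (s - 1) 1 = s - 1 from max_eq_left (by linarith)] at hV
    exact wc_transport (hC5 N z) hz (lt_of_lt_of_le one_pos (le_max_right _ _))
      (max_le (by linarith) (by linarith)) hV hgood
  -- induction on the integer ceiling `k` of the right endpoint
  suffices H : ∀ k : ℕ, ∀ σ s : ℝ, 1 ≤ σ → σ ≤ s → s ≤ σ + 1 → s ≤ (k : ℝ) → s ≤ (N : ℝ) →
      modelEval N σ z ≠ 0 ∧ modelEval N s z ≠ 0 ∧
        0 ≤ (modelEval N s z / modelEval N σ z).im ∧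
          0 < (z * modelEval N σ z / modelEval N s z).im from
    H N σ₀ s₀ h1σ₀ hσs₀ hs1₀ hsN₀ hsN₀
  intro k
  induction k with
  | zero =>
    intro σ s h1σ hσs _ hsk _
    exfalso
    push_cast at hsk
    linarith
  | succ k ih =>
    -- first kind: the left endpoint is `≤ k`
    have hfirst : ∀ σ s : ℝ, 1 ≤ σ → σ ≤ s → s ≤ σ + 1 → s ≤ (k : ℝ) + 1 → s ≤ (N : ℝ) →
        σ ≤ (k : ℝ) →
        modelEval N σ z ≠ 0 ∧ modelEval N s z ≠ 0 ∧
          0 ≤ (modelEval N s z / modelEval N σ z).im ∧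
            0 < (z * modelEval N σ z / modelEval N s z).im := by
      intro σ s h1σ hσs hs1 _ hsN hσk
      by_cases hsk : s ≤ (k : ℝ)
      · exact ih σ s h1σ hσs hs1 hsk hsN
      by_cases hs2 : s ≤ 2
      · exact hbase σ s h1σ (hσs.trans hsN) (hσs.trans hs2) hs2
      push Not at hsk hs2
      refine htrans σ s h1σ hσs hs2 hsN fun u hu => ?_
      have hu1 : 1 ≤ u := (le_max_right _ _).trans hu.1
      have hσu : σ - 1 ≤ u := (le_max_left _ _).trans hu.1
      exact ih u σ hu1 (by linarith [hu.2]) (by linarith) hσk (hσs.trans hsN)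
    intro σ s h1σ hσs hs1 hsk1 hsN
    push_cast at hsk1
    by_cases hσk : σ ≤ (k : ℝ)
    · exact hfirst σ s h1σ hσs hs1 hsk1 hsN hσk
    -- second kind: `k < σ ≤ s ≤ k + 1`
    push Not at hσk
    by_cases hs2 : s ≤ 2
    · exact hbase σ s h1σ (hσs.trans hsN) (hσs.trans hs2) hs2
    push Not at hs2
    refine htrans σ s h1σ hσs hs2 hsN fun u hu => ?_
    have hu1 : 1 ≤ u := (le_max_right _ _).trans hu.1
    have hσu : σ - 1 ≤ u := (le_max_left _ _).trans hu.1
    exact hfirst u σ hu1 (by linarith [hu.2]) (by linarith) (hσs.trans hsk1) (hσs.trans hsN)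
      (by linarith [hu.2])

/-- **No null window** from continuity (C5) and the delay equation (C6): if `G_N(·;z)` (`z ≠ 0`)
vanished on `[a, a+1] ⊆ [1, N]` with `a > 2`, uniqueness of derivatives in (C6) forces it to vanish
on `(a-1, a)`, hence on `[a-1, a]` by continuity; descending to a window with left end `≤ 2`
contradicts `G_N ≡ 1` there. -/
private theorem wc_noNull
    (hC5 : ∀ N : ℕ, ∀ z : ℂ, Continuous (fun τ : ℝ => modelEval N τ z))
    (hC6 : ∀ N : ℕ, 2 ≤ N → ∀ z : ℂ, ∀ τ : ℝ, 2 < τ → τ ≤ (N : ℝ) + 1 →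
      HasDerivAt (fun t : ℝ => modelEval N t z) (z * modelEval N (τ - 1) z / ((τ : ℂ) - 1)) τ) :
    NoNullWindow := by
  intro N z hz a₀ ha₀ ha₀N
  by_contra hcon
  push Not at hcon
  have hN2 : 2 ≤ N := by exact_mod_cast (show (2 : ℝ) ≤ N by linarith)
  have hN1 : 1 ≤ N := le_trans (by norm_num) hN2
  -- descending induction on the integer ceiling `m` of the left endpoint
  suffices H : ∀ m : ℕ, ∀ a : ℝ, 1 ≤ a → a ≤ (m : ℝ) → a + 1 ≤ (N : ℝ) →
      (∀ τ ∈ Set.Icc a (a + 1), modelEval N τ z = 0) → False from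
    H ⌈a₀⌉₊ a₀ ha₀ (Nat.le_ceil a₀) ha₀N hcon
  intro m
  induction m with
  | zero =>
    intro a ha ham _ _
    push_cast at ham
    linarith
  | succ m ih =>
    intro a ha ham haN hzero
    push_cast at ham
    by_cases ha2 : a ≤ 2
    · have h1 := hzero a ⟨le_rfl, by linarith⟩
      rw [modelEval_of_le_two hN1 ha2] at h1
      exact one_ne_zero h1
    push Not at ha2
    -- `G` vanishes on `Ioo (a-1) a` by the delay equation and uniqueness of derivatives
    have hIoo : Set.Ioo (a - 1) a ⊆ {u : ℝ | modelEval N u z = 0} := by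
      intro u hu
      have hu2 : 2 < u + 1 := by linarith [hu.1]
      have huN : u + 1 ≤ (N : ℝ) + 1 := by linarith [hu.2]
      have h6 := hC6 N hN2 z (u + 1) hu2 huN
      have hmem : Set.Ioo a (a + 1) ∈ nhds (u + 1) :=
        Ioo_mem_nhds (by linarith [hu.1]) (by linarith [hu.2])
      have heq : (fun t : ℝ => modelEval N t z) =ᶠ[nhds (u + 1)] fun _ => (0 : ℂ) :=
        Filter.eventuallyEq_of_mem hmem fun t ht => hzero t (Set.Ioo_subset_Icc_self ht)
      have h0 : HasDerivAt (fun t : ℝ => modelEval N t z) 0 (u + 1) :=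
        (hasDerivAt_const (u + 1) (0 : ℂ)).congr_of_eventuallyEq heq
      have huniq := h6.unique h0
      rw [add_sub_cancel_right, div_eq_zero_iff, mul_eq_zero] at huniq
      rcases huniq with (h | h) | h
      · exact absurd h hz
      · exact h
      · exfalso
        have hu0 : (u : ℂ) = 0 := by rw [← h]; push_cast; ring
        have hu0' := Complex.ofReal_eq_zero.1 hu0
        linarith [hu.1]
    have hcl : closure (Set.Ioo (a - 1) a) ⊆ {u : ℝ | modelEval N u z = 0} :=
      (isClosed_eq (hC5 N z) continuous_const).closure_subset_iff.2 hIoo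
    rw [closure_Ioo (by linarith : a - 1 ≠ a)] at hcl
    refine ih (a - 1) (by linarith) (by linarith) (by linarith) fun τ hτ => hcl ⟨hτ.1, ?_⟩
    linarith [hτ.2]


/-! ## The registered stub -/

/-- **THE LEVER of the line `window-chain-transport`.** From the calculus bundle `DensityCalculus`
(only (C5) continuity, (C6) the delay equation and (C7) its Volterra form are used):
* `WindowChain N` for every `N`: for `1 ≤ τ ≤ t ≤ τ + 1`, `t ≤ N`, `Im z > 0`, the model family
  `G_N(·;z)` does not vanish at `τ, t` and the Hermite–Biehler positivity pair
  `Im(G_N(t;z)/G_N(τ;z)) ≥ 0`, `Im(z G_N(τ;z)/G_N(t;z)) > 0` holds — transported across integer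
  windows by the Volterra identity and linearity of `Im` under the interval integral;
* `NoNullWindow`: for `z ≠ 0`, `G_N(·;z)` vanishes on no unit window `[a, a+1] ⊆ [1, N]`
  (backward uniqueness for the delay equation). -/
theorem stub_windowChain : DensityCalculus → (∀ N : ℕ, WindowChain N) ∧ NoNullWindow := by
  intro h
  obtain ⟨-, -, -, -, hC5, hC6, hC7⟩ := h
  exact ⟨wc_chain hC5 hC7, wc_noNull hC5 hC6⟩

end Summit.Parity.GeneralizedHardyLittlewood.Cruxes.ModelHyperbolicity.WindowChainTransport

end
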